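import Literature.Topology.FourManifolds.GluedDesc
import Literature.Topology.FourManifolds.MorseChartChange
import HarnessLib

/-!
# Maps out of a glued manifold: descent, smoothness, critical points and Hessians on the pieces

Topic `Literature/Topology/FourManifolds`; a pure-proof companion of `GluingConstruction.lean`
(the open pushout `A ∪_ψ B = d.Glued` of two boundaryless smooth manifolds along a partial
diffeomorphism `ψ`, `d : SmoothGlueData I_A I_B A B E_P`; Kosinski, *Differential Manifolds*
(1993), VI.1). Written for Milnor's `S³`-bundles over `S⁴` (Milnor, *On manifolds homeomorphic
to the 7-sphere*, Ann. of Math. 64 (1956), §3), whose total spaces are such pushouts of two copies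
of `ℝ⁴ × S³` and on which Milnor's function `f` (Lemma 5) is defined piece by piece.

Everything here is **proved**; no named fact is introduced.

* (`SmoothGlueData.desc`, the map `A ∪_ψ B → X` defined by maps on the pieces agreeing along
  `ψ`, is the tree's `GluedDesc.lean`; here: `desc_comp_inl`, `desc_comp_inr`, `continuous_desc`,
  `eq_of_comp_inl_eq_of_comp_inr_eq`.)
* `SmoothGlueData.retrA e` / `retrB e` — the local retraction `A ∪_ψ B → A` attached to a chart
  `e` of `A`: `e⁻¹ ∘ T_A⁻¹ ∘ chartA e`, smooth on `inl '' e.source` and a left inverse of `inl`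
  there; hence every map `F` out of the glued space agrees with `(F ∘ inl) ∘ retrA e` near
  `inl a` (`eventuallyEq_comp_inl_retrA`).
* `SmoothGlueData.contMDiffAt_inl_iff`, `contMDiffAt_inr_iff`, `contMDiff_iff_comp_inl_inr`
  — a map out of `A ∪_ψ B` is `C^∞` iff its restrictions to the two pieces are (the tree's
  `contMDiff_desc`, `GluedDesc.lean`, is the "if" half for descended maps).
* `SmoothGlueData.isMCriticalPt_inl_iff`, `isMCriticalPt_inr_iff` — `inl a` is a critical point of
  `F : A ∪_ψ B → ℝ` iff `a` is a critical point of `F ∘ inl` (Milnor, *Morse theory* (1963), §2).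
* `SmoothGlueData.hessianInChart_chartA_apply`, `nondegenerate_hessianInChart_chartA_iff` (and `B`)
  — the Hessian of `F` at `inl a` read in the lifted chart `chartA e` is the Hessian of `F ∘ inl`
  at `a` read in `e`, transported by the linear identification `linA : E_A ≃L E_P` of the model
  spaces; in particular the two are nondegenerate together.

## References

* A. Kosinski, *Differential Manifolds*, Academic Press (1993), VI.1. [Kosinski1993]
* J. Milnor, *On manifolds homeomorphic to the 7-sphere*, Ann. of Math. 64 (1956), 399–405, §3.
  [Milnor1956]
* J. Milnor, *Morse theory*, Ann. of Math. Studies 51 (1963), §2. [Milnor1963]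
-/

open scoped Manifold ContDiff Topology
open Set Function Filter OpenPartialHomeomorph

noncomputable section

namespace Literature.Topology.FourManifolds

namespace SmoothGlueData

universe uA uB

variable {E_A H_A E_B H_B : Type*}
  [NormedAddCommGroup E_A] [NormedSpace ℝ E_A] [TopologicalSpace H_A]
  [NormedAddCommGroup E_B] [NormedSpace ℝ E_B] [TopologicalSpace H_B]
  {I_A : ModelWithCorners ℝ E_A H_A} {I_B : ModelWithCorners ℝ E_B H_B}
  {A : Type uA} [TopologicalSpace A] [ChartedSpace H_A A]
  {B : Type uB} [TopologicalSpace B] [ChartedSpace H_B B]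
  {E_P : Type*} [NormedAddCommGroup E_P] [NormedSpace ℝ E_P]
  (d : SmoothGlueData I_A I_B A B E_P)

/-! ### Descent of maps to the pushout (complements to `GluedDesc.lean`) -/

section Desc

variable {X : Type*} {fA : A → X} {fB : B → X} {h : ∀ a, a ∈ d.glue.source → fA a = fB (d.glue a)}

/-- `desc f_A f_B ∘ inl = f_A` (definitional). [folklore] -/
@[simp] theorem desc_comp_inl : d.desc fA fB h ∘ d.inl = fA := rfl

/-- `desc f_A f_B ∘ inr = f_B` (definitional). [folklore] -/
@[simp] theorem desc_comp_inr : d.desc fA fB h ∘ d.inr = fB := rfl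

end Desc

/-- A map out of the pushout is determined by its restrictions to the pieces. [folklore] -/
theorem eq_of_comp_inl_eq_of_comp_inr_eq {X : Type*} {F G : d.Glued → X}
    (hA : F ∘ d.inl = G ∘ d.inl) (hB : F ∘ d.inr = G ∘ d.inr) : F = G := by
  funext p
  obtain (⟨a, rfl⟩ | ⟨b, rfl⟩) := d.exists_inl_or_inr p
  · exact congrFun hA a
  · exact congrFun hB b

/-- The descended map is continuous if `f_A` and `f_B` are. [folklore] -/
theorem continuous_desc {X : Type*} [TopologicalSpace X] {fA : A → X} {fB : B → X}
    {h : ∀ a, a ∈ d.glue.source → fA a = fB (d.glue a)} (hA : Continuous fA) (hB : Continuous fB) :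
    Continuous (d.desc fA fB h) := by
  rw [d.isQuotientMap_proj.continuous_iff]
  exact hA.sumElim hB

/-! ### Local retractions onto the pieces -/

section Retraction

variable [I_A.Boundaryless] [I_B.Boundaryless]

/-- The local retraction `A ∪_ψ B → A` attached to a chart `e` of `A`: `e⁻¹ ∘ T_A⁻¹ ∘ chartA e`
(total, meaningful on `inl '' e.source`). [folklore] -/
def retrA (e : OpenPartialHomeomorph A H_A) : d.Glued → A :=
  e.symm ∘ d.modelHomeoA.symm ∘ d.chartA e

/-- The local retraction `A ∪_ψ B → B` attached to a chart `e` of `B`. [folklore] -/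
def retrB (e : OpenPartialHomeomorph B H_B) : d.Glued → B :=
  e.symm ∘ d.modelHomeoB.symm ∘ d.chartB e

variable {d}

omit [I_B.Boundaryless] in
/-- `retrA e` is a left inverse of `inl` on `e.source`. [folklore] -/
@[simp] theorem retrA_inl {e : OpenPartialHomeomorph A H_A} {a : A} (ha : a ∈ e.source) :
    d.retrA e (d.inl a) = a := by
  simp [retrA, e.left_inv ha]

omit [I_A.Boundaryless] in
/-- `retrB e` is a left inverse of `inr` on `e.source`. [folklore] -/
@[simp] theorem retrB_inr {e : OpenPartialHomeomorph B H_B} {b : B} (hb : b ∈ e.source) :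
    d.retrB e (d.inr b) = b := by
  simp [retrB, e.left_inv hb]

omit [I_B.Boundaryless] in
/-- Near `inl a`, every map out of the glued space factors through the first piece:
`F = (F ∘ inl) ∘ retrA e` on the neighbourhood `inl '' e.source`. [folklore] -/
theorem eventuallyEq_comp_inl_retrA {X : Type*} (F : d.Glued → X)
    {e : OpenPartialHomeomorph A H_A} {a : A} (ha : a ∈ e.source) :
    F =ᶠ[𝓝 (d.inl a)] (F ∘ d.inl) ∘ d.retrA e := by
  filter_upwards [(d.isOpenMap_inl _ e.open_source).mem_nhds (mem_image_of_mem _ ha)]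
    with p hp
  obtain ⟨a', ha', rfl⟩ := hp
  simp [retrA_inl ha']

omit [I_A.Boundaryless] in
/-- Near `inr b`, every map out of the glued space factors through the second piece. [folklore] -/
theorem eventuallyEq_comp_inr_retrB {X : Type*} (F : d.Glued → X)
    {e : OpenPartialHomeomorph B H_B} {b : B} (hb : b ∈ e.source) :
    F =ᶠ[𝓝 (d.inr b)] (F ∘ d.inr) ∘ d.retrB e := by
  filter_upwards [(d.isOpenMap_inr _ e.open_source).mem_nhds (mem_image_of_mem _ hb)]
    with p hp
  obtain ⟨b', hb', rfl⟩ := hp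
  simp [retrB_inr hb']

variable [IsManifold I_A ∞ A] [IsManifold I_B ∞ B]

/-- The local retraction `retrA e` is smooth on `inl '' e.source` for `e` in the maximal
atlas of `A`. [folklore] -/
theorem contMDiffOn_retrA {e : OpenPartialHomeomorph A H_A}
    (he : e ∈ IsManifold.maximalAtlas I_A ∞ A) :
    ContMDiffOn 𝓘(ℝ, E_P) I_A ∞ (d.retrA e) (d.chartA e).source := by
  have h1 : ContMDiffOn 𝓘(ℝ, E_P) 𝓘(ℝ, E_P) ∞ (d.chartA e) (d.chartA e).source :=
    contMDiffOn_of_mem_maximalAtlas (IsManifold.subset_maximalAtlas (d.chartA_mem_atlas he))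
  have h2 : ContMDiffOn 𝓘(ℝ, E_P) I_A ∞ (d.modelHomeoA.symm ∘ d.chartA e) (d.chartA e).source :=
    d.contMDiff_modelHomeoA_symm.comp_contMDiffOn h1
  refine (contMDiffOn_symm_of_mem_maximalAtlas he).comp h2 ?_
  intro p hp
  exact (d.chartA e).map_source hp

/-- The local retraction `retrB e` is smooth on `inr '' e.source`. [folklore] -/
theorem contMDiffOn_retrB {e : OpenPartialHomeomorph B H_B}
    (he : e ∈ IsManifold.maximalAtlas I_B ∞ B) :
    ContMDiffOn 𝓘(ℝ, E_P) I_B ∞ (d.retrB e) (d.chartB e).source := by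
  have h1 : ContMDiffOn 𝓘(ℝ, E_P) 𝓘(ℝ, E_P) ∞ (d.chartB e) (d.chartB e).source :=
    contMDiffOn_of_mem_maximalAtlas (IsManifold.subset_maximalAtlas (d.chartB_mem_atlas he))
  have h2 : ContMDiffOn 𝓘(ℝ, E_P) I_B ∞ (d.modelHomeoB.symm ∘ d.chartB e) (d.chartB e).source :=
    d.contMDiff_modelHomeoB_symm.comp_contMDiffOn h1
  refine (contMDiffOn_symm_of_mem_maximalAtlas he).comp h2 ?_
  intro p hp
  exact (d.chartB e).map_source hp

/-- `retrA (chartAt a)` is smooth at `inl a`. [folklore] -/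
theorem contMDiffAt_retrA_chartAt (a : A) :
    ContMDiffAt 𝓘(ℝ, E_P) I_A ∞ (d.retrA (chartAt H_A a)) (d.inl a) :=
  (contMDiffOn_retrA (IsManifold.chart_mem_maximalAtlas a)).contMDiffAt
    ((d.chartA _).open_source.mem_nhds ⟨a, mem_chart_source H_A a, rfl⟩)

/-- `retrB (chartAt b)` is smooth at `inr b`. [folklore] -/
theorem contMDiffAt_retrB_chartAt (b : B) :
    ContMDiffAt 𝓘(ℝ, E_P) I_B ∞ (d.retrB (chartAt H_B b)) (d.inr b) :=
  (contMDiffOn_retrB (IsManifold.chart_mem_maximalAtlas b)).contMDiffAt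
    ((d.chartB _).open_source.mem_nhds ⟨b, mem_chart_source H_B b, rfl⟩)

end Retraction

/-! ### Smoothness of maps out of the glued space -/

section Smooth

variable [I_A.Boundaryless] [I_B.Boundaryless] [IsManifold I_A ∞ A] [IsManifold I_B ∞ B]
  {E' H' : Type*} [NormedAddCommGroup E'] [NormedSpace ℝ E'] [TopologicalSpace H']
  {I' : ModelWithCorners ℝ E' H'} {M' : Type*} [TopologicalSpace M'] [ChartedSpace H' M']
variable {d}

/-- **A map out of `A ∪_ψ B` is smooth at `inl a` iff its restriction to `A` is smooth at `a`**
(`inl` is an open embedding and a diffeomorphism onto its image; Kosinski, VI.1). [folklore] -/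
theorem contMDiffAt_inl_iff {F : d.Glued → M'} {a : A} :
    ContMDiffAt 𝓘(ℝ, E_P) I' ∞ F (d.inl a) ↔ ContMDiffAt I_A I' ∞ (F ∘ d.inl) a := by
  refine ⟨fun hF => hF.comp a d.contMDiff_inl.contMDiffAt, fun hF => ?_⟩
  have hr := d.contMDiffAt_retrA_chartAt a
  have hc : ContMDiffAt 𝓘(ℝ, E_P) I' ∞ ((F ∘ d.inl) ∘ d.retrA (chartAt H_A a)) (d.inl a) := by
    refine ContMDiffAt.comp (d.inl a) ?_ hr
    rw [retrA_inl (mem_chart_source H_A a)]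
    exact hF
  exact hc.congr_of_eventuallyEq (eventuallyEq_comp_inl_retrA F (mem_chart_source H_A a))

/-- A map out of `A ∪_ψ B` is smooth at `inr b` iff its restriction to `B` is smooth at `b`. [folklore] -/
theorem contMDiffAt_inr_iff {F : d.Glued → M'} {b : B} :
    ContMDiffAt 𝓘(ℝ, E_P) I' ∞ F (d.inr b) ↔ ContMDiffAt I_B I' ∞ (F ∘ d.inr) b := by
  refine ⟨fun hF => hF.comp b d.contMDiff_inr.contMDiffAt, fun hF => ?_⟩
  have hr := d.contMDiffAt_retrB_chartAt b
  have hc : ContMDiffAt 𝓘(ℝ, E_P) I' ∞ ((F ∘ d.inr) ∘ d.retrB (chartAt H_B b)) (d.inr b) := by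
    refine ContMDiffAt.comp (d.inr b) ?_ hr
    rw [retrB_inr (mem_chart_source H_B b)]
    exact hF
  exact hc.congr_of_eventuallyEq (eventuallyEq_comp_inr_retrB F (mem_chart_source H_B b))

/-- **A map out of `A ∪_ψ B` is smooth iff both restrictions `F ∘ inl`, `F ∘ inr` are**
(Kosinski, VI.1). [folklore] -/
theorem contMDiff_iff_comp_inl_inr {F : d.Glued → M'} :
    ContMDiff 𝓘(ℝ, E_P) I' ∞ F ↔
      ContMDiff I_A I' ∞ (F ∘ d.inl) ∧ ContMDiff I_B I' ∞ (F ∘ d.inr) := by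
  refine ⟨fun hF => ⟨hF.comp d.contMDiff_inl, hF.comp d.contMDiff_inr⟩, fun hF p => ?_⟩
  obtain (⟨a, rfl⟩ | ⟨b, rfl⟩) := d.exists_inl_or_inr p
  · exact contMDiffAt_inl_iff.2 (hF.1 a)
  · exact contMDiffAt_inr_iff.2 (hF.2 b)

end Smooth

/-! ### Critical points of real functions on the glued space -/

section Critical

variable [I_A.Boundaryless] [I_B.Boundaryless] [IsManifold I_A ∞ A] [IsManifold I_B ∞ B]
variable {d}

/-- **Critical points are detected on the pieces**: for `F : A ∪_ψ B → ℝ` differentiable at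
`inl a`, `inl a` is a critical point of `F` iff `a` is a critical point of `F ∘ inl` (the
differential of the open embedding `inl` is invertible; Milnor, *Morse theory*, §2). [cite: Milnor1963, §2] -/
theorem isMCriticalPt_inl_iff {F : d.Glued → ℝ} {a : A}
    (hF : MDifferentiableAt 𝓘(ℝ, E_P) 𝓘(ℝ, ℝ) F (d.inl a)) :
    IsMCriticalPt 𝓘(ℝ, E_P) F (d.inl a) ↔ IsMCriticalPt I_A (F ∘ d.inl) a := by
  have hinl : MDifferentiableAt I_A 𝓘(ℝ, E_P) d.inl a :=
    d.contMDiff_inl.mdifferentiableAt (by simp)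
  unfold IsMCriticalPt
  constructor
  · intro h
    rw [mfderiv_comp a hF hinl, h, ContinuousLinearMap.zero_comp]
    rfl
  · intro h
    have ha := mem_chart_source H_A a
    have hr : MDifferentiableAt 𝓘(ℝ, E_P) I_A (d.retrA (chartAt H_A a)) (d.inl a) :=
      (d.contMDiffAt_retrA_chartAt a).mdifferentiableAt (by simp)
    have hfi : MDifferentiableAt I_A 𝓘(ℝ, ℝ) (F ∘ d.inl) a := hF.comp a hinl
    rw [(eventuallyEq_comp_inl_retrA F ha).mfderiv_eq,
      mfderiv_comp_of_eq hfi hr (retrA_inl ha), retrA_inl ha, h, ContinuousLinearMap.zero_comp]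
    rfl

/-- Critical points are detected on the second piece. [cite: Milnor1963, §2] -/
theorem isMCriticalPt_inr_iff {F : d.Glued → ℝ} {b : B}
    (hF : MDifferentiableAt 𝓘(ℝ, E_P) 𝓘(ℝ, ℝ) F (d.inr b)) :
    IsMCriticalPt 𝓘(ℝ, E_P) F (d.inr b) ↔ IsMCriticalPt I_B (F ∘ d.inr) b := by
  have hinr : MDifferentiableAt I_B 𝓘(ℝ, E_P) d.inr b :=
    d.contMDiff_inr.mdifferentiableAt (by simp)
  unfold IsMCriticalPt
  constructor
  · intro h
    rw [mfderiv_comp b hF hinr, h, ContinuousLinearMap.zero_comp]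
    rfl
  · intro h
    have hb := mem_chart_source H_B b
    have hr : MDifferentiableAt 𝓘(ℝ, E_P) I_B (d.retrB (chartAt H_B b)) (d.inr b) :=
      (d.contMDiffAt_retrB_chartAt b).mdifferentiableAt (by simp)
    have hfi : MDifferentiableAt I_B 𝓘(ℝ, ℝ) (F ∘ d.inr) b := hF.comp b hinr
    rw [(eventuallyEq_comp_inr_retrB F hb).mfderiv_eq,
      mfderiv_comp_of_eq hfi hr (retrB_inr hb), retrB_inr hb, h, ContinuousLinearMap.zero_comp]
    rfl

/-- A point `inl a` with `a ∈ ψ.source` is also `inr (ψ a)`; criticality there may be read on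
either piece. [folklore] -/
theorem isMCriticalPt_inl_iff_of_mem_source {F : d.Glued → ℝ} {a : A} (ha : a ∈ d.glue.source)
    (hF : MDifferentiableAt 𝓘(ℝ, E_P) 𝓘(ℝ, ℝ) F (d.inl a)) :
    IsMCriticalPt 𝓘(ℝ, E_P) F (d.inl a) ↔ IsMCriticalPt I_B (F ∘ d.inr) (d.glue a) := by
  rw [← d.inr_glue ha] at hF ⊢
  exact isMCriticalPt_inr_iff hF

end Critical

/-! ### The Hessian read in a lifted chart -/

section Hessian

variable [I_A.Boundaryless] [I_B.Boundaryless]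
variable {d}

omit [I_B.Boundaryless] in
/-- In the lifted chart `chartA e`, a function on the glued space reads as the function
`F ∘ inl` read in the chart `e` of `A`, precomposed with `linA⁻¹`. [folklore] -/
theorem comp_chartA_extend_symm (e : OpenPartialHomeomorph A H_A) (F : d.Glued → ℝ) :
    F ∘ ((d.chartA e).extend 𝓘(ℝ, E_P)).symm =
      ((F ∘ d.inl) ∘ (e.extend I_A).symm) ∘ (d.linA.symm : E_P → E_A) := by
  funext z
  simp [chartA, OpenPartialHomeomorph.extend]

omit [I_A.Boundaryless] in
/-- In the lifted chart `chartB e`, a function on the glued space reads as `F ∘ inr` read in `e`,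
precomposed with `linB⁻¹`. [folklore] -/
theorem comp_chartB_extend_symm (e : OpenPartialHomeomorph B H_B) (F : d.Glued → ℝ) :
    F ∘ ((d.chartB e).extend 𝓘(ℝ, E_P)).symm =
      ((F ∘ d.inr) ∘ (e.extend I_B).symm) ∘ (d.linB.symm : E_P → E_B) := by
  funext z
  simp [chartB, OpenPartialHomeomorph.extend]

omit [I_B.Boundaryless] in
/-- The image of `inl a` in the lifted chart is `linA` of the image of `a` in `e`. [folklore] -/
theorem chartA_extend_apply_inl (e : OpenPartialHomeomorph A H_A) (a : A) :
    (d.chartA e).extend 𝓘(ℝ, E_P) (d.inl a) = d.linA (e.extend I_A a) := by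
  simp [OpenPartialHomeomorph.extend]

omit [I_A.Boundaryless] in
/-- The image of `inr b` in the lifted chart is `linB` of the image of `b` in `e`. [folklore] -/
theorem chartB_extend_apply_inr (e : OpenPartialHomeomorph B H_B) (b : B) :
    (d.chartB e).extend 𝓘(ℝ, E_P) (d.inr b) = d.linB (e.extend I_B b) := by
  simp [OpenPartialHomeomorph.extend]

/-- Second derivative of a function precomposed with a linear isomorphism: `D²(G ∘ L)(x)(v, w) =
D²G(L x)(L v, L w)` (no differentiability hypothesis: both sides are junk together). [folklore] -/
theorem fderiv_fderiv_comp_continuousLinearEquiv_apply {E₁ E₂ : Type*} [NormedAddCommGroup E₁]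
    [NormedSpace ℝ E₁] [NormedAddCommGroup E₂] [NormedSpace ℝ E₂] (G : E₂ → ℝ) (L : E₁ ≃L[ℝ] E₂)
    (x v w : E₁) :
    fderiv ℝ (fderiv ℝ (G ∘ (L : E₁ → E₂))) x v w = fderiv ℝ (fderiv ℝ G) (L x) (L v) (L w) := by
  have h1 : fderiv ℝ (G ∘ (L : E₁ → E₂)) = fun y => (fderiv ℝ G (L y)).comp (L : E₁ →L[ℝ] E₂) := by
    funext y
    exact L.comp_right_fderiv
  have h2 : (fun y => (fderiv ℝ G (L y)).comp (L : E₁ →L[ℝ] E₂)) =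
      (L.symm.arrowCongr (ContinuousLinearEquiv.refl ℝ ℝ) : (E₂ →L[ℝ] ℝ) → (E₁ →L[ℝ] ℝ)) ∘
        ((fderiv ℝ G) ∘ (L : E₁ → E₂)) := by
    funext y
    ext u
    simp
  rw [h1, h2, ContinuousLinearEquiv.comp_fderiv, L.comp_right_fderiv]
  simp

omit [I_B.Boundaryless] in
/-- **The Hessian in a lifted chart.** For `F : A ∪_ψ B → ℝ`, the Hessian at `inl a` read in the
chart `chartA e` of the glued space is the Hessian of `F ∘ inl` at `a` read in the chart `e` of
`A`, transported along `linA⁻¹ : E_P ≃ E_A` (Milnor, *Morse theory*, §2: the matrix of second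
partial derivatives in local coordinates). [cite: Milnor1963, §2] -/
theorem hessianInChart_chartA_apply (e : OpenPartialHomeomorph A H_A) (F : d.Glued → ℝ) (a : A)
    (v w : E_P) :
    hessianInChart 𝓘(ℝ, E_P) (d.chartA e) F (d.inl a) v w =
      hessianInChart I_A e (F ∘ d.inl) a (d.linA.symm v) (d.linA.symm w) := by
  rw [hessianInChart_apply_apply, hessianInChart_apply_apply, comp_chartA_extend_symm,
    chartA_extend_apply_inl, ModelWithCorners.Boundaryless.range_eq_univ,
    ModelWithCorners.Boundaryless.range_eq_univ, fderivWithin_univ, fderivWithin_univ,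
    fderiv_fderiv_comp_continuousLinearEquiv_apply]
  simp

omit [I_A.Boundaryless] in
/-- The Hessian at `inr b` read in `chartB e` is the Hessian of `F ∘ inr` at `b` read in `e`,
transported along `linB⁻¹`. [cite: Milnor1963, §2] -/
theorem hessianInChart_chartB_apply (e : OpenPartialHomeomorph B H_B) (F : d.Glued → ℝ) (b : B)
    (v w : E_P) :
    hessianInChart 𝓘(ℝ, E_P) (d.chartB e) F (d.inr b) v w =
      hessianInChart I_B e (F ∘ d.inr) b (d.linB.symm v) (d.linB.symm w) := by
  rw [hessianInChart_apply_apply, hessianInChart_apply_apply, comp_chartB_extend_symm,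
    chartB_extend_apply_inr, ModelWithCorners.Boundaryless.range_eq_univ,
    ModelWithCorners.Boundaryless.range_eq_univ, fderivWithin_univ, fderivWithin_univ,
    fderiv_fderiv_comp_continuousLinearEquiv_apply]
  simp

omit [I_B.Boundaryless] in
/-- **Nondegeneracy of the Hessian is detected on the pieces** (congruent bilinear forms). [cite: Milnor1963, §2] -/
theorem nondegenerate_hessianInChart_chartA_iff (e : OpenPartialHomeomorph A H_A)
    (F : d.Glued → ℝ) (a : A) :
    (hessianInChart 𝓘(ℝ, E_P) (d.chartA e) F (d.inl a)).Nondegenerate ↔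
      (hessianInChart I_A e (F ∘ d.inl) a).Nondegenerate :=
  nondegenerate_iff_of_forall_apply_eq d.linA.symm.toLinearEquiv fun v w =>
    hessianInChart_chartA_apply e F a v w

omit [I_A.Boundaryless] in
/-- Nondegeneracy of the Hessian at `inr b` is detected on the second piece. [cite: Milnor1963, §2] -/
theorem nondegenerate_hessianInChart_chartB_iff (e : OpenPartialHomeomorph B H_B)
    (F : d.Glued → ℝ) (b : B) :
    (hessianInChart 𝓘(ℝ, E_P) (d.chartB e) F (d.inr b)).Nondegenerate ↔
      (hessianInChart I_B e (F ∘ d.inr) b).Nondegenerate :=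
  nondegenerate_iff_of_forall_apply_eq d.linB.symm.toLinearEquiv fun v w =>
    hessianInChart_chartB_apply e F b v w

/-- **Nondegeneracy of the tree's Hessian `mhessian` at a critical point `inl a` of a `C²`
function on the glued space is read on the piece `A`**, in any chart `e` of the `C^∞` maximal
atlas of `A` at `a` (combines `nondegenerate_mhessian_iff` of `MorseChartChange.lean` with the
lifted chart `chartA e`). [cite: Milnor1963, §2] -/
theorem nondegenerate_mhessian_inl_iff [IsManifold I_A ∞ A] [IsManifold I_B ∞ B]
    [IsManifold 𝓘(ℝ, E_P) 2 d.Glued] {F : d.Glued → ℝ} {a : A}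
    (hF : ContMDiffAt 𝓘(ℝ, E_P) 𝓘(ℝ, ℝ) 2 F (d.inl a)) (hc : IsMCriticalPt 𝓘(ℝ, E_P) F (d.inl a))
    {e : OpenPartialHomeomorph A H_A} (he : e ∈ IsManifold.maximalAtlas I_A ∞ A)
    (ha : a ∈ e.source) :
    (mhessian 𝓘(ℝ, E_P) F (d.inl a)).Nondegenerate ↔
      (hessianInChart I_A e (F ∘ d.inl) a).Nondegenerate := by
  have he2 : d.chartA e ∈ IsManifold.maximalAtlas 𝓘(ℝ, E_P) 2 d.Glued :=
    IsManifold.maximalAtlas_subset_of_le (M := d.Glued) (I := 𝓘(ℝ, E_P)) (m := 2) (n := ∞)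
      (by norm_cast) (IsManifold.subset_maximalAtlas (d.chartA_mem_atlas he))
  rw [nondegenerate_mhessian_iff hF hc he2 ⟨a, ha, rfl⟩, nondegenerate_hessianInChart_chartA_iff]

/-- Nondegeneracy of `mhessian` at a critical point `inr b` is read on the piece `B`. [cite: Milnor1963, §2] -/
theorem nondegenerate_mhessian_inr_iff [IsManifold I_A ∞ A] [IsManifold I_B ∞ B]
    [IsManifold 𝓘(ℝ, E_P) 2 d.Glued] {F : d.Glued → ℝ} {b : B}
    (hF : ContMDiffAt 𝓘(ℝ, E_P) 𝓘(ℝ, ℝ) 2 F (d.inr b)) (hc : IsMCriticalPt 𝓘(ℝ, E_P) F (d.inr b))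
    {e : OpenPartialHomeomorph B H_B} (he : e ∈ IsManifold.maximalAtlas I_B ∞ B)
    (hb : b ∈ e.source) :
    (mhessian 𝓘(ℝ, E_P) F (d.inr b)).Nondegenerate ↔
      (hessianInChart I_B e (F ∘ d.inr) b).Nondegenerate := by
  have he2 : d.chartB e ∈ IsManifold.maximalAtlas 𝓘(ℝ, E_P) 2 d.Glued :=
    IsManifold.maximalAtlas_subset_of_le (M := d.Glued) (I := 𝓘(ℝ, E_P)) (m := 2) (n := ∞)
      (by norm_cast) (IsManifold.subset_maximalAtlas (d.chartB_mem_atlas he))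
  rw [nondegenerate_mhessian_iff hF hc he2 ⟨b, hb, rfl⟩, nondegenerate_hessianInChart_chartB_iff]

end Hessian

end SmoothGlueData

end Literature.Topology.FourManifolds
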